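import Literature.Probability.Percolation.QSMPolynomials
import Literature.Probability.Percolation.RussoFormula
import Literature.Probability.Percolation.SitePercolationMeasure
import HarnessLib

/-!
# Block decoding of i.i.d. coins: cylinder probabilities of a decoded configuration

Ninth file of the inline proof of `Literature.Probability.Percolation.MartineauSevero2019_cor22` (a generic
tool). In Martineau–Severo's coupling (Ann. Probab. 47 (2019), §5) the percolation configurations are READ OFF
families of i.i.d. coins: on `ℋ`, `ω_e = ∨_{k ≤ M} ω_{(e,k)}` ("`p̂`-percolation on `Ĥ` corresponds to
`p`-percolation on `ℋ`", `p̂ = 1-(1-p)^{1/M}`) and the mark `α_u`; on `𝒢` likewise `η_e = ∨_k η_{(e,k)}`. When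
each decoded coordinate `i` depends on its own finite block of coins and the blocks are disjoint, the decoded
configuration has independent coordinates, so the probability of a LOCAL event of the decoded configuration is
the weighted count `ProdWeight.gTheta` with coordinate weights `θ_i = ℙ(coordinate i decoded open)`:

* `sitePercolation_real_blockCylinder`, `sitePercolation_real_decode_mem_eq_gTheta` — the block-decoding
  formula under `sitePercolation I q` (all coins `Ber(q)`);
* `sitePercolation_real_exists_mem` — an OR-block of `k` coins is open with probability `1 - (1-q)^k`
  (an AND-block with probability `q^k` is the tree's `sitePercolation_real_subset`);
* `cylPoly_eq_gTheta` — on the percolation side, `Russo.cylPoly u K B p = gTheta K B (· ↦ p)` for `K ⊆ u`, so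
  that `(bondPercolation G p)(B) = gTheta K B (· ↦ p)` for `B` determined by a finite set `K` of edges of `G`
  (`bondPercolation_real_eq_gTheta`).

No infinite-product push-forward is needed: everything is finite-dimensional.

## References

* S. Martineau, F. Severo, Ann. Probab. 47 (2019), §5 ("p̂-percolation on Ĥ corresponds to p-percolation on
  ℋ"; Step ∞) [MartineauSevero2019].
* L. Russo, Z. Wahrsch. verw. Gebiete 56 (1981), §4 (cylinder probabilities) [RussoZW1981].
-/

noncomputable section

namespace Literature.Probability.Percolation

open MeasureTheory ProbabilityTheory
open scoped ENNReal Classical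

variable {I ι : Type*}

/-! ### OR-blocks -/

/-- **An OR-block of coins**: `P_q(some coin of B open) = 1 - (1-q)^{|B|}`.
[cite: MartineauSevero2019, §5 ("p̂ := 1-(1-p)^{1/M}")] -/
theorem sitePercolation_real_exists_mem (q : unitInterval) (B : Finset I) :
    (sitePercolation I q).real {c | ∃ i ∈ B, i ∈ c} = 1 - (1 - q : ℝ) ^ B.card := by
  have hnone : (sitePercolation I q).real {c | ∀ i ∈ B, i ∉ c} = (1 - q : ℝ) ^ B.card := by
    rw [measureReal_def, sitePercolation_apply']
    have : ((fun χ : I → Prop => {v | χ v}) ⁻¹' {ω : SiteConfig I | ∀ i ∈ B, i ∉ ω}) =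
        Set.pi ↑B fun _ => {False} := by
      ext χ; simp
    rw [this, sitePi, Measure.infinitePi_pi _ (fun _ _ => measurableSet_singleton _), Finset.prod_const,
      ENNReal.toReal_pow, ← measureReal_def, bernoulliProp_real_false]
  have hm : MeasurableSet {c : Set I | ∀ i ∈ B, i ∉ c} := by
    refine DeterminedBy.measurableSet_of_finset (F := B) ?_
    rw [determinedBy_iff]
    intro ω ω' h
    simp only [Set.mem_setOf_eq]
    refine forall₂_congr fun i hi => not_congr ?_
    exact ⟨fun hm => ((Set.ext_iff.1 h i).1 ⟨hm, hi⟩).1, fun hm => ((Set.ext_iff.1 h i).2 ⟨hm, hi⟩).1⟩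
  have : {c : Set I | ∃ i ∈ B, i ∈ c} = {c | ∀ i ∈ B, i ∉ c}ᶜ := by ext c; simp
  rw [this, measureReal_compl hm, probReal_univ, hnone]

/-! ### Block decoding -/

section Decode

variable (blk : ι → Finset I) (dec : ι → Set I → Prop)

/-- The **decoded configuration**: coordinate `i` is open iff its decoder says so.
[cite: MartineauSevero2019, §5 ("((∨_k ω_{e,k})_e, α)")] -/
def blockDecode (c : Set I) : Set ι := {i | dec i c}

/-- Membership in the decoded configuration. [folklore] -/
@[simp] theorem mem_blockDecode {c : Set I} {i : ι} : i ∈ blockDecode dec c ↔ dec i c := Iff.rfl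

variable {blk dec}

/-- Configurations agreeing on the block of `i` decode `i` identically. [folklore] -/
theorem dec_iff_of_agree (hdec : ∀ i, DeterminedBy {c | dec i c} ↑(blk i)) (i : ι) {ω ω' : Set I}
    (hω : ω ∩ ↑(blk i) = ω' ∩ ↑(blk i)) : dec i ω ↔ dec i ω' := by
  have h := hdec i
  rw [determinedBy_iff] at h
  exact h ω ω' hω

/-- Configurations agreeing on a union of blocks decode each of its coordinates identically. [folklore] -/
theorem dec_iff_of_agree_biUnion (hdec : ∀ i, DeterminedBy {c | dec i c} ↑(blk i)) {K : Finset ι} {i : ι}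
    (hi : i ∈ K) {ω ω' : Set I} (hω : ω ∩ ↑(K.biUnion blk) = ω' ∩ ↑(K.biUnion blk)) : dec i ω ↔ dec i ω' := by
  refine dec_iff_of_agree hdec i ?_
  ext x
  simp only [Set.mem_inter_iff, Finset.mem_coe]
  constructor
  · rintro ⟨hx, hxb⟩
    have := (Set.ext_iff.1 hω x).1 ⟨hx, Finset.mem_coe.2 (Finset.mem_biUnion.2 ⟨i, hi, hxb⟩)⟩
    exact ⟨this.1, hxb⟩
  · rintro ⟨hx, hxb⟩
    have := (Set.ext_iff.1 hω x).2 ⟨hx, Finset.mem_coe.2 (Finset.mem_biUnion.2 ⟨i, hi, hxb⟩)⟩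
    exact ⟨this.1, hxb⟩

/-- The event "coordinate `i` decodes as prescribed" is determined by the block of `i`. [folklore] -/
theorem determinedBy_dec_iff (hdec : ∀ i, DeterminedBy {c | dec i c} ↑(blk i)) (i : ι) (P : Prop) :
    DeterminedBy {c : Set I | dec i c ↔ P} ↑(blk i) := by
  rw [determinedBy_iff]
  intro ω ω' hω
  simp only [Set.mem_setOf_eq]
  rw [dec_iff_of_agree hdec i hω]

/-- The block cylinder event is determined by the union of the blocks. [folklore] -/
theorem determinedBy_blockCylinder (hdec : ∀ i, DeterminedBy {c | dec i c} ↑(blk i)) (K S : Finset ι) :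
    DeterminedBy {c : Set I | ∀ i ∈ K, (dec i c ↔ i ∈ S)} ↑(K.biUnion blk) := by
  rw [determinedBy_iff]
  intro ω ω' hω
  simp only [Set.mem_setOf_eq]
  refine forall₂_congr fun i hi => ?_
  rw [dec_iff_of_agree_biUnion hdec hi hω]

/-- **The block cylinder formula.** If the decoders read disjoint blocks, then for `S ⊆ K`
`P_q(∀ i ∈ K, (i decoded open ↔ i ∈ S)) = ∏_{i ∈ K} w_i(S)` with `w_i(S) = θ_i` or `1 - θ_i`,
`θ_i = P_q(i decoded open)` (independence of disjoint blocks). [cite: MartineauSevero2019, §5 (Step ∞)] -/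
theorem sitePercolation_real_blockCylinder (q : unitInterval) (hdec : ∀ i, DeterminedBy {c | dec i c} ↑(blk i))
    (hdisj : ∀ i j, i ≠ j → Disjoint (blk i) (blk j)) (K : Finset ι) (S : Finset ι) :
    (sitePercolation I q).real {c | ∀ i ∈ K, (dec i c ↔ i ∈ S)} =
      ∏ i ∈ K, ProdWeight.gwt (fun i => (sitePercolation I q).real {c | dec i c}) S i := by
  induction K using Finset.induction_on with
  | empty => simp
  | @insert a K ha ih =>
    rw [Finset.prod_insert ha, ← ih]
    have hsplit : {c : Set I | ∀ i ∈ insert a K, (dec i c ↔ i ∈ S)} =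
        {c | dec a c ↔ a ∈ S} ∩ {c | ∀ i ∈ K, (dec i c ↔ i ∈ S)} := by
      ext c; simp
    -- the two events are determined by disjoint coin sets
    have hA : DeterminedBy {c : Set I | dec a c ↔ a ∈ S} ↑(blk a) := determinedBy_dec_iff hdec a _
    have hB : DeterminedBy {c : Set I | ∀ i ∈ K, (dec i c ↔ i ∈ S)} ↑(K.biUnion blk) :=
      determinedBy_blockCylinder hdec K S
    have hAB : Disjoint (blk a) (K.biUnion blk) := by
      rw [Finset.disjoint_biUnion_right]
      intro i hi
      exact hdisj a i fun h => ha (h ▸ hi)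
    rw [hsplit, sitePercolation_real_inter_of_disjoint q hA hB hAB]
    congr 1
    -- the one-block factor
    unfold ProdWeight.gwt
    by_cases haS : a ∈ S
    · simp only [haS, iff_true, if_true]
    · simp only [haS, iff_false, if_false]
      have hm : MeasurableSet {c : Set I | dec a c} := (hdec a).measurableSet_of_finset
      have : {c : Set I | ¬ dec a c} = {c | dec a c}ᶜ := rfl
      rw [this, measureReal_compl hm, probReal_univ]

/-- **Block decoding.** For an event `A` of the decoded configuration determined by the finite set `K` of
coordinates: `P_q(decoded ∈ A) = Σ_{S ⊆ K, S ∈ A} ∏_{i ∈ K} w_i(S) = gTheta K A θ`, `θ_i = P_q(i decoded open)`.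
[cite: MartineauSevero2019, §5 (Step ∞: "C_∞ has the distribution of the cluster of the origin for the (p,s)-process")] -/
theorem sitePercolation_real_decode_mem_eq_gTheta (q : unitInterval) (hdec : ∀ i, DeterminedBy {c | dec i c} ↑(blk i))
    (hdisj : ∀ i j, i ≠ j → Disjoint (blk i) (blk j)) {A : Set (Set ι)} {K : Finset ι}
    (hA : DeterminedBy A ↑K) :
    (sitePercolation I q).real {c | blockDecode dec c ∈ A} =
      ProdWeight.gTheta K A (fun i => (sitePercolation I q).real {c | dec i c}) := by
  have hdecomp : {c : Set I | blockDecode dec c ∈ A} =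
      ⋃ S ∈ K.powerset.filter (fun S : Finset ι => (↑S : Set ι) ∈ A), {c | ∀ i ∈ K, (dec i c ↔ i ∈ S)} := by
    ext c
    conv_lhs => rw [Set.mem_setOf_eq, hA.eq_biUnion_localCylinder]
    simp only [Set.mem_iUnion, Set.mem_setOf_eq, localCylinder, Finset.mem_coe, mem_blockDecode, exists_prop]
  rw [hdecomp, measureReal_biUnion_finset]
  · unfold ProdWeight.gTheta ProdWeight.gW
    rw [Finset.sum_filter]
    refine Finset.sum_congr rfl fun S _ => ?_
    split_ifs
    · exact sitePercolation_real_blockCylinder q hdec hdisj K S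
    · rfl
  · intro S hS T hT hST
    simp only [Finset.coe_filter, Set.mem_setOf_eq, Finset.mem_powerset] at hS hT
    refine Set.disjoint_left.2 fun c hcS hcT => hST ?_
    ext i
    constructor
    · intro hi; exact ((hcT i (hS.1 hi)).1 ((hcS i (hS.1 hi)).2 hi))
    · intro hi; exact ((hcS i (hT.1 hi)).1 ((hcT i (hT.1 hi)).2 hi))
  · intro S _
    exact (determinedBy_blockCylinder hdec K S).measurableSet_of_finset

end Decode

/-! ### The percolation side -/

/-- For a finite set `K ⊆ u` of coordinates, Russo's cylinder polynomial of `setBer(u, ·)` is the weighted count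
with all weights equal to the parameter. [cite: RussoZW1981, §4 Lemma 3 (proof)] -/
theorem cylPoly_eq_gTheta {u : Set ι} {K : Finset ι} (hK : (↑K : Set ι) ⊆ u) (B : Set (Set ι)) (q : ℝ) :
    Russo.cylPoly u K B q = ProdWeight.gTheta K B (fun _ => q) := by
  unfold Russo.cylPoly ProdWeight.gTheta ProdWeight.gW
  refine Finset.sum_congr rfl fun S _ => ?_
  split_ifs
  · refine Finset.prod_congr rfl fun i hi => ?_
    have hiu : i ∈ u := hK (Finset.mem_coe.2 hi)
    simp [Russo.weight, ProdWeight.gwt, hiu]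
  · rfl

/-- **Bond percolation probabilities of local events as weighted counts**: for `B` determined by a finite set
`K` of edges of `G`, `P_{G,p}(B) = gTheta K B (· ↦ p)`. [cite: RussoZW1981, §4 Lemma 3 (proof)] -/
theorem bondPercolation_real_eq_gTheta {V : Type*} (G : SimpleGraph V) (p : unitInterval) {B : Set (Set (Sym2 V))}
    {K : Finset (Sym2 V)} (hB : DeterminedBy B ↑K) (hK : (↑K : Set (Sym2 V)) ⊆ G.edgeSet) :
    (bondPercolation G p).real B = ProdWeight.gTheta K B (fun _ => (p : ℝ)) := by
  rw [bondPercolation, Russo.measureReal_eq_cylPoly hB, cylPoly_eq_gTheta hK]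

end Literature.Probability.Percolation
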